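import Summits.CriticalPhenomena.PercolationContinuityZ3.Theorems.PercNearOneGluingAdditiveGluingCSHSetDefs
import Summits.CriticalPhenomena.PercolationContinuityZ3.Theorems.PercNearOneGluingNoHeavyLowerTailCSHUnfold
import Summits.CriticalPhenomena.PercolationContinuityZ3.Theorems.PercNearOneGluingNoHeavyLowerTailCovTauMetaA2Defs
import HarnessLib

/-!
# Conjecture G / SET-W via a SET observer, XI: DEFINITIONS for the world-wise unfolding (U) and the two-source
# inequality (H) of the set-observer conditioned slack hierarchy

Definitions file (`--supports stmt-CriticalPhenomena-4576`), seat (b) V⁺-form `png-dp-vplus`, gen 13 (memo MEMO-gen12.md §4(b)–(d),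
§10 (U),(H) of run/shared/lean/prim/prim-png-dp-vplus/).  No named facts, no sorries; standard axioms.  The tree holds conjecture G
(`stub_fingerML3_vp`, `K < 1`) ⟸ `CSHSet.CSHSetHolds` (`CSHSet.fingerML3_of_cshSet`) ⟸ the one-level unfolding step `hU` of
`CSHSet.cshSetHolds_of_unfold` (`…SetObserverInduction.lean`).  The step is prim-hp-8's Lemma U + Lemma H (`CSH.within_unfold`,
`CSH.hpart_nonneg`) with the observer `o` replaced by an observer SET `O` in the slot `none : Option V`; this file fixes the vocabulary.

* Set-slot versions of the pointwise algebra of `…NoHeavyLowerTailCSHLevelForms.lean` (`CSH.jn`, `CSH.chi`, `CSH.unfoldT`), for an abstract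
  relation `R` (open reachability in a world), an observer set `O` and a real "liveness" factor `ℓ` (in the application
  `ℓ = 1{O ∩ V(C_Y) = ∅}`, a constant of the world):
  `jnO R O ℓ S` (`none ↦ ℓ·1{O ~ S}`, `some u ↦ J_S(u)`), `chiO R O ℓ S d` (`none ↦ ℓ·1{O ~ d}·1{O ≁ S}` — the RULE of memo §3: the
  observer is killed when it touches the avoided set —, `some u ↦ χ_d(u)`), and the unfolded terms `unfoldTO` (recursion along a decoy list
  whose decoys are vertex slots `some d`).
* `subTO` — the accumulated lower-level terms of the unfolding at a slot (set version of `CSH.subT`: the sub-system lists are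
  `CSHSet.decoyListSet`, the covariances `CSHSet.covDSet` of prim-hp-8's functional `CSH.phiT`).
* `CovTau.EavSet`, `CovTau.qavSet` — the observer functionals of the generic two-source induction META-A2 (`…CovTauMetaA2Defs.lean`) for the
  killed set observer: `E^O_A(N) = μ_{G[U]}({O ~ v} ∩ {O ≁ A ∪ N})`, `q^O_A(U) = 1{O ⊆ U}·E^O_A(∅)/M_A(∅)` (the liveness factor `1{O ⊆ U}`
  makes `q^O_A(U ∖ C_Y) = 0` in a dead world).
[cite: VandenbergHaggstromKahn2005, §1 p. 3, §2.1 (pp. 9–13)] [cite: KozmaNitzan2024, Conj. 4 (p. 32)]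
-/

noncomputable section

namespace Summit.CriticalPhenomena.PercolationContinuityZ3.Theorems

open MeasureTheory Set Literature.Probability.LatticeModels Literature.Probability.Percolation
open scoped Classical

namespace CSHSet

open CSH HullPort

variable {V : Type*}

section Unfold

variable (R : V → V → Prop) (O : Finset V) (ℓ : ℝ)

/-- **`J_S` with a set-observer slot**: `none ↦ ℓ·1{∃ o ∈ O, ∃ s ∈ S, o R s}` (`ℓ·1{O ~ S}`), `some u ↦ CSH.jn R S u`.
(transcription of the cell memo png-dp-vplus MEMO-gen12.md §4(b)) [folklore] -/
def jnO (S : Set V) : Option V → ℝ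
  | none => ℓ * (if ∃ o ∈ O, ∃ s ∈ S, R o s then 1 else 0)
  | some u => jn R S u

/-- **The slot indicators of "sees `C_d` conditioned to avoid `S`"**: `none ↦ ℓ·1{(∃ o ∈ O, o R d) ∧ ∀ o ∈ O, ∀ s ∈ S, ¬ o R s}`
(the rule `g_O(d;S) = 1{O ~ d}·1{O ≁ S}`), `some u ↦ CSH.chi R u d`. (transcription of the cell memo png-dp-vplus MEMO-gen12.md §3, §4(b)) [folklore] -/
def chiO (S : Set V) (d : V) : Option V → ℝ
  | none => ℓ * (if (∃ o ∈ O, R o d) ∧ (∀ o ∈ O, ∀ s ∈ S, ¬ R o s) then 1 else 0)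
  | some u => chi R u d

/-- **The unfolded terms with a set-observer slot** (set version of `CSH.unfoldT`): `unfoldTO_S([]) = 0`,
`unfoldTO_S((some d, c) :: L') = ε_S(d)·sl_{L'}[chiO_S(d) − c] + unfoldTO_{S∪{d}}(L')` (a head `(none, c)` — never produced by
`CSHSet.decoyListSet` — is skipped). (transcription of the cell memo png-dp-vplus MEMO-gen12.md §4(b)) [folklore] -/
def unfoldTO : Set V → List (Option V × (Option V → ℝ)) → Option V → ℝ
  | _, [] => fun _ => 0
  | S, (none, _) :: L' => unfoldTO S L'
  | S, (some d, c) :: L' => fun s =>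
      av R S d * slForm L' (fun s' => chiO R O ℓ S d s' - c s') s + unfoldTO (insert d S) L' s

/-- The set slot of `jnO`. [folklore] -/
@[simp] theorem jnO_none (S : Set V) : jnO R O ℓ S none = ℓ * (if ∃ o ∈ O, ∃ s ∈ S, R o s then 1 else 0) := rfl

/-- The vertex slots of `jnO`. [folklore] -/
@[simp] theorem jnO_some (S : Set V) (u : V) : jnO R O ℓ S (some u) = jn R S u := rfl

/-- The set slot of `chiO`. [folklore] -/
@[simp] theorem chiO_none (S : Set V) (d : V) :
    chiO R O ℓ S d none = ℓ * (if (∃ o ∈ O, R o d) ∧ (∀ o ∈ O, ∀ s ∈ S, ¬ R o s) then 1 else 0) := rfl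

/-- The vertex slots of `chiO`. [folklore] -/
@[simp] theorem chiO_some (S : Set V) (d u : V) : chiO R O ℓ S d (some u) = chi R u d := rfl

/-- No decoys. [folklore] -/
@[simp] theorem unfoldTO_nil (S : Set V) : unfoldTO R O ℓ S [] = fun _ => 0 := rfl

/-- Unfolding at a vertex decoy. [folklore] -/
@[simp] theorem unfoldTO_cons_some (S : Set V) (d : V) (c : Option V → ℝ) (L' : List (Option V × (Option V → ℝ))) :
    unfoldTO R O ℓ S ((some d, c) :: L') = fun s =>
      av R S d * slForm L' (fun s' => chiO R O ℓ S d s' - c s') s + unfoldTO R O ℓ (insert d S) L' s := rfl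

/-- A head with the set slot is skipped. [folklore] -/
@[simp] theorem unfoldTO_cons_none (S : Set V) (c : Option V → ℝ) (L' : List (Option V × (Option V → ℝ))) :
    unfoldTO R O ℓ S ((none, c) :: L') = unfoldTO R O ℓ S L' := rfl

end Unfold

/-- **The accumulated lower-level terms of the set-observer unfolding at the slot `s`** (set version of `CSH.subT`): a recursion along the
decoy list with a growing source set `S` (owner + earlier decoys): `subTO_S([]) = 0`,
`subTO_S(d :: ds) = μ(d ↮ S∪Y)⁻¹ · sl_{L_{>d}}[covDSet_{d,S∪Y}(Φ̃_d)](s) + subTO_{S∪{d}}(ds)`.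
(transcription of the cell memo png-dp-vplus MEMO-gen12.md §4(b)) [folklore] -/
def subTO (w : Sym2 V → unitInterval) (x : V) (Y : Set V) (g : Set (Sym2 V) → ℝ) (O : Finset V) (s : Option V) :
    Set V → List V → ℝ
  | _, [] => 0
  | S, d :: ds => ((prodBernoulli w).real (avoidEv d (S ∪ Y)))⁻¹ *
        slForm (decoyListSet w O (insert d (S ∪ Y)) ds) (covDSet w d (S ∪ Y) (phiT w x Y g d) O) s +
      subTO w x Y g O s (insert d S) ds

/-- No decoys. [folklore] -/
@[simp] theorem subTO_nil (w : Sym2 V → unitInterval) (x : V) (Y : Set V) (g : Set (Sym2 V) → ℝ) (O : Finset V) (s : Option V)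
    (S : Set V) : subTO w x Y g O s S [] = 0 := rfl

/-- Unfolding the first decoy. [folklore] -/
theorem subTO_cons (w : Sym2 V → unitInterval) (x : V) (Y : Set V) (g : Set (Sym2 V) → ℝ) (O : Finset V) (s : Option V)
    (S : Set V) (d : V) (ds : List V) :
    subTO w x Y g O s S (d :: ds) = ((prodBernoulli w).real (avoidEv d (S ∪ Y)))⁻¹ *
        slForm (decoyListSet w O (insert d (S ∪ Y)) ds) (covDSet w d (S ∪ Y) (phiT w x Y g d) O) s +
      subTO w x Y g O s (insert d S) ds := rfl

end CSHSet

namespace CovTau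

open Literature.Probability.Percolation.BHK2006
open Literature.Probability.Percolation.DecisionTree (ind ind_of_mem ind_of_not_mem ind_nonneg)

variable {V : Type*} [Fintype V]

/-- **`E^O_A(N) = μ_{G[U]}({O ~ v} ∩ {O ≁ A ∪ N})`** — the observer functional of META-A2 for a killed SET observer
(`…CovTauMetaA2Defs.lean`'s `CovTau.Eav` has `1{o ∈ C_v}·1{v ↮ A ∪ N}` instead).
(transcription of the cell memo png-dp-vplus MEMO-gen12.md §4(d)) [folklore] -/
def EavSet (w : Sym2 V → ℝ) (U : Finset V) (A : Set V) (O : Finset V) (v : V) (N : Set V) : ℝ :=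
  ∑ ω, weight w ω * ind ({ω : Set (Sym2 V) | ∃ o ∈ O, (openGraph (ω ∩ edgesIn U)).Reachable o v} ∩
    {ω | ∀ o ∈ O, ∀ a ∈ A ∪ N, ¬ (openGraph (ω ∩ edgesIn U)).Reachable o a}) ω

/-- **`q^O_A(U) = 1{O ⊆ U}·E^O_A(∅)/M_A(∅)`** (`= 1{O ⊆ U}·μ_{G[U]}(O ~ v, O ≁ A | v ↮ A)`; `0` if `M_A(∅) = 0`).
(transcription of the cell memo png-dp-vplus MEMO-gen12.md §4(d)) [folklore] -/
def qavSet (w : Sym2 V → ℝ) (U : Finset V) (A : Set V) (O : Finset V) (v : V) : ℝ :=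
  (if O ⊆ U then 1 else 0) * (EavSet w U A O v ∅ / Mav w U A v ∅)

end CovTau

end Summit.CriticalPhenomena.PercolationContinuityZ3.Theorems

end
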